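import Literature.MathematicalPhysics.QuantumFieldTheory.Balaban1983to89.UnitaryModel

/-!
# Spine/NE7/QLaSchurChannel — the SCHUR CHANNEL of the dressed quotients: for a mean matrix commuting with the gauge group
# (the mean of a conjugation-invariant law) and an exterior holonomy with real trace,
# `Re tr(H₀·E[h])∕N − Re tr H₀∕N = Re tr H₀∕N · (Re tr E[h]∕N − 1)` — the non-abelian form of
# `E[cos(x + F₀)] − cos F₀ = −cos F₀ · E[1 − cos x]`; Schur's lemma for the defining representations of `U(n)` and `SU(n)` PROVED

Cell `pub-balaban-gaps` (YM blitz Y1, track G2, seat `ne7`, generation 3); text of record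
`run/shared/lean/pub/pub-balaban-gaps/ne/NE7.md` v3 §4quater (iii) and census row R29.  Seventh `Spine/NE7/` file; imports the
tree's `UnitaryModel` only (independent of `QLaCriticality`).

WHY.  `Spine/NE7/QLaCriticality` closes the first-order channel of (QL-a) at the TRIVIAL exterior field (`H₀ = 1`, criticality).
NE7.md v2.2 §4ter had read the constants at a flat NEAR-exterior with an arbitrary far loop holonomy (`F₀ ≠ 0` in the abelian
formula `E[cos(⟨w,θ⟩ + F₀)] − cos F₀ = −cos F₀·E[2 sin²(⟨w,θ⟩∕2)] − sin F₀·E sin⟨w,θ⟩`, the last term vanishing by the symmetry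
`θ ↦ −θ` of the law).  This file gives the non-abelian form of that identity: if the MEAN `Eh` of the component's holonomy factor
commutes with the gauge group (which is what conjugation-invariance of the quotient's fibre law — `T4AdInvariant`'s setting —
and equivariance of `h` give; the mean itself is NODE O's object and enters here as a matrix HYPOTHESIS) then `Eh` is a SCALAR
(Schur's lemma for the defining representation — PROVED here for `U(n)` via diagonal sign and permutation unitaries, and for
`SU(n)` via diagonal phase matrices `diag(…, I, …, −I, …)` and signed swaps, all of determinant `1`), and for an exterior
holonomy `H₀` with REAL trace (every `SU(2)` matrix: `trace_im_eq_zero_of_mem_specialUnitaryGroup_two`, PROVED from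
`Uᴴ = U⁻¹ = adj U`) the expectation of the loop variable splits EXACTLY:
`Re tr(H₀·Eh)∕n − Re tr H₀∕n = (Re tr H₀∕n)·(Re tr Eh∕n − 1)` (`schur_channel`, `schur_channel_special`) — the traceless
(«`sin F₀`») part of `Eh` is killed by Schur instead of by `θ ↦ −θ`, and what is left is `W(H₀)` times the MEAN DEFECT
`Re tr Eh∕n − 1`, which `QLaCriticality.one_sub_nReTr_le_half_opDist1_sq` bounds by `½E‖h − 1‖²_op` (second order) once `Eh`
is an average of unitaries.  So in that reading too the first-order channel is absent for Ad-invariant near-exteriors.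

HONEST FRAMING.  Pure matrix algebra over `ℂ` (Mathlib), [folklore]; NO measure, NO density of Bałaban's, NO claim that any
particular quotient law IS conjugation invariant (that is row NE1′'s located obligation (α) of `t4/T4-EST-O3Ei1.md` ∕
`T4AdInvariant`); the matrices `signDiag`, `permMat`, `phaseDiag`, `signedSwap` are test elements for Schur's lemma, nothing
physical.  NE7 NOT proved; spine 0∕9; fixed finite T⁴ — NOT ℝ⁴, NOT a mass gap, NOT Clay.  Census effect: R29 moves from
[analysis] to kernel.
-/

noncomputable section

open scoped BigOperators Matrix Matrix.Norms.L2Operator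

namespace Summit.QuantumFields.BalabanUV.T4Continuum.Spine.NE7

open Literature.MathematicalPhysics.QuantumFieldTheory.Balaban1983to89.UnitaryModel

variable {n : Type*} [Fintype n] [DecidableEq n]

/-! ## §1 Schur's lemma for the defining representation of `U(n)` -/

/-- Test element: the diagonal SIGN matrix flipping coordinate `i` (unitary, determinant `−1`). [folklore] -/
def signDiag (i : n) : Matrix n n ℂ := Matrix.diagonal fun k => if k = i then -1 else 1

/-- `signDiag i` is unitary. [folklore] -/
theorem signDiag_mem_unitaryGroup (i : n) : signDiag i ∈ Matrix.unitaryGroup n ℂ := by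
  rw [Matrix.mem_unitaryGroup_iff, signDiag, Matrix.star_eq_conjTranspose, Matrix.diagonal_conjTranspose,
    Matrix.diagonal_mul_diagonal, ← Matrix.diagonal_one]
  congr 1
  funext k
  by_cases hk : k = i <;> simp [hk]

/-- Test element: the permutation matrix of `σ` (entries `0∕1`; unitary). [folklore] -/
def permMat (σ : Equiv.Perm n) : Matrix n n ℂ := σ.toPEquiv.toMatrix

omit [Fintype n] in
/-- The adjoint of a permutation matrix is the matrix of the inverse permutation. [folklore] -/
theorem permMat_conjTranspose (σ : Equiv.Perm n) : (permMat σ)ᴴ = permMat σ⁻¹ := by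
  ext a b
  simp only [permMat, Matrix.conjTranspose_apply, PEquiv.toMatrix_apply, Equiv.toPEquiv_apply,
    Option.mem_def, Option.some.injEq]
  have hinv : ∀ x, σ⁻¹ x = σ.symm x := fun x => rfl
  by_cases h : σ b = a
  · have h' : σ.symm a = b := by rw [← h]; simp
    simp [h, h', hinv]
  · have h' : ¬ σ.symm a = b := fun h'' => h (by rw [← h'']; simp)
    simp [h, h', hinv]

/-- `P_σ · P_{σ⁻¹} = 1`. [folklore] -/
theorem permMat_mul_permMat_inv (σ : Equiv.Perm n) : permMat σ * permMat σ⁻¹ = 1 := by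
  rw [permMat, permMat, ← PEquiv.toMatrix_trans, ← Equiv.toPEquiv_trans]
  have : σ.trans σ⁻¹ = Equiv.refl n := by ext x; simp
  rw [this, Equiv.toPEquiv_refl, PEquiv.toMatrix_refl]

/-- Permutation matrices are unitary. [folklore] -/
theorem permMat_mem_unitaryGroup (σ : Equiv.Perm n) : permMat σ ∈ Matrix.unitaryGroup n ℂ := by
  rw [Matrix.mem_unitaryGroup_iff, Matrix.star_eq_conjTranspose, permMat_conjTranspose]
  exact permMat_mul_permMat_inv σ

/-- **SCHUR FOR THE DEFINING REPRESENTATION OF `U(n)`**: a matrix commuting with every unitary matrix is scalar — off-diagonal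
entries vanish by the sign matrices, diagonal entries agree by the swaps. [folklore] -/
theorem exists_smul_one_of_commute_unitary (M : Matrix n n ℂ)
    (h : ∀ U ∈ Matrix.unitaryGroup n ℂ, U * M = M * U) (i₀ : n) : M = M i₀ i₀ • (1 : Matrix n n ℂ) := by
  -- off-diagonal entries vanish
  have hoff : ∀ i j, i ≠ j → M i j = 0 := by
    intro i j hij
    have e := congrFun (congrFun (h _ (signDiag_mem_unitaryGroup i)) i) j
    rw [signDiag, Matrix.diagonal_mul, Matrix.mul_diagonal] at e
    simp only [if_true, if_neg (Ne.symm hij)] at e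
    -- e : -1 * M i j = M i j * 1
    have : (2 : ℂ) * M i j = 0 := by linear_combination -e
    simpa using this
  -- diagonal entries agree
  have hdiag : ∀ i j, M i i = M j j := by
    intro i j
    by_cases hij : i = j
    · rw [hij]
    have e := congrFun (congrFun (h _ (permMat_mem_unitaryGroup (Equiv.swap i j))) i) j
    rw [permMat, PEquiv.toMatrix_toPEquiv_mul, PEquiv.mul_toMatrix_toPEquiv] at e
    simpa [Matrix.submatrix_apply, Equiv.swap_apply_left, Equiv.symm_swap, Equiv.swap_apply_right] using e.symm
  ext a b
  by_cases hab : a = b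
  · subst hab
    simp [hdiag a i₀]
  · simp [hoff a b hab, hab]

/-! ## §2 The Schur channel -/

/-- **THE SCHUR CHANNEL.**  For a matrix `Eh` commuting with every unitary (e.g. the mean of a conjugation-invariant unitary-valued law) and `H₀` with
REAL trace: `Re tr(H₀·Eh)∕n − Re tr H₀∕n = Re tr H₀∕n · (Re tr Eh∕n − 1)` — the traceless part of `Eh` is absent (Schur),
the rest is `W(H₀)` times the mean defect. [folklore] -/
theorem schur_channel [Nonempty n] {H₀ Eh : Matrix n n ℂ} (hcomm : ∀ U ∈ Matrix.unitaryGroup n ℂ, U * Eh = Eh * U)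
    (hreal : (Matrix.trace H₀).im = 0) : nReTr (H₀ * Eh) - nReTr H₀ = nReTr H₀ * (nReTr Eh - 1) := by
  obtain ⟨i₀⟩ := ‹Nonempty n›
  have hE := exists_smul_one_of_commute_unitary Eh hcomm i₀
  set c : ℂ := Eh i₀ i₀ with hc
  have hN : (Fintype.card n : ℝ) ≠ 0 := Nat.cast_ne_zero.mpr Fintype.card_ne_zero
  have htrE : nReTr Eh = c.re := by
    rw [hE, nReTr, Matrix.trace_smul, Matrix.trace_one, smul_eq_mul]
    simp only [Complex.mul_re, Complex.natCast_re, Complex.natCast_im, mul_zero, sub_zero]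
    field_simp
  have htrHE : nReTr (H₀ * Eh) = c.re * nReTr H₀ := by
    rw [hE, Matrix.mul_smul, Matrix.mul_one, nReTr, nReTr, Matrix.trace_smul, smul_eq_mul, Complex.mul_re, hreal,
      mul_zero, sub_zero]
    ring
  rw [htrHE, htrE]
  ring

/-- **TRACES OF `SU(2)` MATRICES ARE REAL**: `U₁₁ = conj U₀₀` (unitarity and `det = 1`: `Uᴴ = U⁻¹ = adj U`), so every
`SU(2)` exterior holonomy qualifies as `H₀` in `schur_channel`. [folklore] -/
theorem trace_im_eq_zero_of_mem_specialUnitaryGroup_two {U : Matrix (Fin 2) (Fin 2) ℂ}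
    (hU : U ∈ Matrix.specialUnitaryGroup (Fin 2) ℂ) : (Matrix.trace U).im = 0 := by
  rw [Matrix.mem_specialUnitaryGroup_iff] at hU
  obtain ⟨hUu, hdet⟩ := hU
  have h1 : star U * U = 1 := Unitary.star_mul_self_of_mem hUu
  have hinv : U⁻¹ = star U := Matrix.inv_eq_left_inv h1
  have hadj : U⁻¹ = U.adjugate := by rw [Matrix.inv_def, hdet, Ring.inverse_one, one_smul]
  have e : star U = U.adjugate := hinv.symm.trans hadj
  have e00 := congrFun (congrFun e 0) 0
  rw [Matrix.adjugate_fin_two, Matrix.star_apply] at e00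
  simp only [Matrix.of_apply, Matrix.cons_val', Matrix.cons_val_zero, Matrix.cons_val_fin_one] at e00
  -- e00 : star (U 0 0) = U 1 1
  rw [Matrix.trace_fin_two, ← e00, Complex.add_im, Complex.star_def, Complex.conj_im]
  ring

/-! ## §3 Schur's lemma for the defining representation of `SU(n)` (the laws are `Ad(SU(N))`-invariant: means commute with `SU(N)` only) -/

/-- Test element: the diagonal PHASE matrix with `I` at `i`, `−I` at `j`, `1` elsewhere (`i ≠ j`): special unitary. [folklore] -/
def phaseDiag (i j : n) : Matrix n n ℂ :=
  Matrix.diagonal fun k => if k = i then Complex.I else if k = j then -Complex.I else 1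

/-- `phaseDiag i j` is unitary. [folklore] -/
theorem phaseDiag_mem_unitaryGroup (i j : n) : phaseDiag i j ∈ Matrix.unitaryGroup n ℂ := by
  rw [Matrix.mem_unitaryGroup_iff, phaseDiag, Matrix.star_eq_conjTranspose, Matrix.diagonal_conjTranspose,
    Matrix.diagonal_mul_diagonal, ← Matrix.diagonal_one]
  congr 1
  funext k
  by_cases hk : k = i
  · simp [hk]
  · by_cases hk' : k = j
    · subst hk'; simp [hk]
    · simp [hk, hk']

/-- `det (phaseDiag i j) = I·(−I) = 1` for `i ≠ j`. [folklore] -/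
theorem det_phaseDiag {i j : n} (hij : i ≠ j) : (phaseDiag i j).det = 1 := by
  classical
  rw [phaseDiag, Matrix.det_diagonal]
  rw [← Finset.prod_erase_mul _ _ (Finset.mem_univ i), ← Finset.prod_erase_mul _ _ (Finset.mem_erase.mpr ⟨hij.symm, Finset.mem_univ j⟩)]
  simp only [if_true, if_neg hij.symm]
  rw [Finset.prod_eq_one]
  · simp
  · intro k hk
    obtain ⟨hkj, hk'⟩ := Finset.mem_erase.mp hk
    obtain ⟨hki, _⟩ := Finset.mem_erase.mp hk'
    simp [hki, hkj]

/-- `phaseDiag i j ∈ SU(n)` for `i ≠ j`. [folklore] -/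
theorem phaseDiag_mem_specialUnitaryGroup {i j : n} (hij : i ≠ j) :
    phaseDiag i j ∈ Matrix.specialUnitaryGroup n ℂ :=
  Matrix.mem_specialUnitaryGroup_iff.mpr ⟨phaseDiag_mem_unitaryGroup i j, det_phaseDiag hij⟩

/-- Test element: the SIGNED SWAP `P_{(ij)} · D_j(−1)` (a quarter turn in the `(i, j)` plane): special unitary. [folklore] -/
def signedSwap (i j : n) : Matrix n n ℂ := permMat (Equiv.swap i j) * signDiag j

/-- `det P_{(ij)} = −1`. [folklore] -/
theorem det_permMat_swap {i j : n} (hij : i ≠ j) : (permMat (Equiv.swap i j)).det = -1 := by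
  rw [permMat, Matrix.det_permutation, Equiv.Perm.sign_swap hij]
  simp

/-- `det D_j(−1) = −1`. [folklore] -/
theorem det_signDiag (j : n) : (signDiag j).det = -1 := by
  classical
  rw [signDiag, Matrix.det_diagonal, ← Finset.prod_erase_mul _ _ (Finset.mem_univ j)]
  simp only [if_true]
  rw [Finset.prod_eq_one]
  · simp
  · intro k hk
    simp [(Finset.mem_erase.mp hk).1]

/-- The signed swap is special unitary (`i ≠ j`). [folklore] -/
theorem signedSwap_mem_specialUnitaryGroup {i j : n} (hij : i ≠ j) :
    signedSwap i j ∈ Matrix.specialUnitaryGroup n ℂ := by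
  refine Matrix.mem_specialUnitaryGroup_iff.mpr ⟨?_, ?_⟩
  · exact Submonoid.mul_mem _ (permMat_mem_unitaryGroup _) (signDiag_mem_unitaryGroup j)
  · rw [signedSwap, Matrix.det_mul, det_permMat_swap hij, det_signDiag]; norm_num

/-- **SCHUR FOR THE DEFINING REPRESENTATION OF `SU(n)`**: a matrix commuting with every special unitary matrix is scalar —
off-diagonal entries vanish by the phase matrices (`2I·M_ij = 0`), diagonal entries agree by the signed swaps. [folklore] -/
theorem exists_smul_one_of_commute_specialUnitary (M : Matrix n n ℂ)
    (h : ∀ U ∈ Matrix.specialUnitaryGroup n ℂ, U * M = M * U) (i₀ : n) : M = M i₀ i₀ • (1 : Matrix n n ℂ) := by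
  -- off-diagonal entries vanish
  have hoff : ∀ i j, i ≠ j → M i j = 0 := by
    intro i j hij
    have e := congrFun (congrFun (h _ (phaseDiag_mem_specialUnitaryGroup hij)) i) j
    rw [phaseDiag, Matrix.diagonal_mul, Matrix.mul_diagonal] at e
    simp only [if_true, if_neg (Ne.symm hij)] at e
    -- e : I * M i j = M i j * -I
    have h2 : (2 * Complex.I) * M i j = 0 := by linear_combination e
    have hI : (2 * Complex.I) ≠ 0 := mul_ne_zero two_ne_zero Complex.I_ne_zero
    exact (mul_eq_zero.mp h2).resolve_left hI
  -- diagonal entries agree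
  have hdiag : ∀ i j, M i i = M j j := by
    intro i j
    by_cases hij : i = j
    · rw [hij]
    have e := congrFun (congrFun (h _ (signedSwap_mem_specialUnitaryGroup hij)) i) j
    rw [signedSwap, permMat, Matrix.mul_assoc, PEquiv.toMatrix_toPEquiv_mul, ← Matrix.mul_assoc,
      PEquiv.mul_toMatrix_toPEquiv] at e
    rw [Matrix.submatrix_apply, signDiag, Matrix.diagonal_mul, Matrix.mul_diagonal, Matrix.submatrix_apply] at e
    simp only [id, Equiv.swap_apply_left, Equiv.symm_swap, Equiv.swap_apply_right, if_true] at e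
    -- e : -1 * M j j = M i i * -1
    linear_combination e
  ext a b
  by_cases hab : a = b
  · subst hab
    simp [hdiag a i₀]
  · simp [hoff a b hab, hab]

/-! ## §4 The Schur channel for `Ad(SU(n))`-invariant means, and the `SU(2)` instance -/

/-- **THE SCHUR CHANNEL, `SU(n)` FORM**: `Eh` commuting with every SPECIAL unitary matrix and `H₀` with real trace give
`Re tr(H₀·Eh)∕n − Re tr H₀∕n = Re tr H₀∕n·(Re tr Eh∕n − 1)`. [folklore] -/
theorem schur_channel_special [Nonempty n] {H₀ Eh : Matrix n n ℂ}
    (hcomm : ∀ U ∈ Matrix.specialUnitaryGroup n ℂ, U * Eh = Eh * U) (hreal : (Matrix.trace H₀).im = 0) :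
    nReTr (H₀ * Eh) - nReTr H₀ = nReTr H₀ * (nReTr Eh - 1) := by
  obtain ⟨i₀⟩ := ‹Nonempty n›
  have hE := exists_smul_one_of_commute_specialUnitary Eh hcomm i₀
  set c : ℂ := Eh i₀ i₀ with hc
  have hN : (Fintype.card n : ℝ) ≠ 0 := Nat.cast_ne_zero.mpr Fintype.card_ne_zero
  have htrE : nReTr Eh = c.re := by
    rw [hE, nReTr, Matrix.trace_smul, Matrix.trace_one, smul_eq_mul]
    simp only [Complex.mul_re, Complex.natCast_re, Complex.natCast_im, mul_zero, sub_zero]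
    field_simp
  have htrHE : nReTr (H₀ * Eh) = c.re * nReTr H₀ := by
    rw [hE, Matrix.mul_smul, Matrix.mul_one, nReTr, nReTr, Matrix.trace_smul, smul_eq_mul, Complex.mul_re, hreal,
      mul_zero, sub_zero]
    ring
  rw [htrHE, htrE]
  ring

/-- **THE `SU(2)` INSTANCE** (the group of [Balaban1987RG1] for N = 2): for EVERY exterior holonomy `H₀ ∈ SU(2)` and every
matrix `Eh` commuting with `SU(2)` (the mean of an `Ad`-invariant `SU(2)`-valued law),
`Re tr(H₀·Eh)∕2 − Re tr H₀∕2 = Re tr H₀∕2·(Re tr Eh∕2 − 1)` — the «`sin F₀`» channel of NE7.md §4ter is absent. [folklore] -/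
theorem schur_channel_SU2 {H₀ Eh : Matrix (Fin 2) (Fin 2) ℂ} (hH : H₀ ∈ Matrix.specialUnitaryGroup (Fin 2) ℂ)
    (hcomm : ∀ U ∈ Matrix.specialUnitaryGroup (Fin 2) ℂ, U * Eh = Eh * U) :
    nReTr (H₀ * Eh) - nReTr H₀ = nReTr H₀ * (nReTr Eh - 1) :=
  schur_channel_special hcomm (trace_im_eq_zero_of_mem_specialUnitaryGroup_two hH)

/-- SANITY: with `Eh = 1` (trivial law) both sides vanish. [folklore] -/
example {H₀ : Matrix (Fin 2) (Fin 2) ℂ} (hH : H₀ ∈ Matrix.specialUnitaryGroup (Fin 2) ℂ) :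
    nReTr (H₀ * 1) - nReTr H₀ = nReTr H₀ * (nReTr (1 : Matrix (Fin 2) (Fin 2) ℂ) - 1) :=
  schur_channel_SU2 hH fun U _ => by rw [Matrix.mul_one, Matrix.one_mul]

end Summit.QuantumFields.BalabanUV.T4Continuum.Spine.NE7

end
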